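import Summits.BirchSwinnertonDyer.Rank1Residual.X10.UnitRoadProp38IntModel
import Summits.BirchSwinnertonDyer.Rank1Residual.X10.UnitRoadPartnerRecordsD
import HarnessLib

/-!
# Class X10b (N2), the TRIVIAL-PARTNER road at `p = 3` WITHOUT Kato 17.4 / `h5`: per-pair RECORDS, part
# D — X_A3 (`MazurMainConjecture W 3`, named facts `h3` + Greenberg–Vatsal (1.4) only) and `BSD(E,3)`
# AT THE PAIR for 4 NON-unit N2 cells (316030dj1, 334282o1, 375518bo1, 444470v1) congruent to a curve of TRIVIAL `3`-primary
# arithmetic (cell `b2b-bsdres`, unit `b2b-bsdres-x10` = N2 class lead, gen 26)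

HONEST FRAMING (run/shared/lean/b2b/bsd-rank1-residual/, verbatim in every file): the goal of the
cell is to DELETE the COMBINATION-SHAPED residual classes of the Birch–Swinnerton-Dyer formula for
ALL analytic-rank `≤ 1` elliptic curves over `ℚ` — "full BSD formula for every rank `≤ 1` curve in
class `C`" assembled STRICTLY from published theorems — so that the rank-`≤ 1` remainder becomes
exactly the CONSTRUCTION-SHAPED classes, which are TYPED (missing-input `Prop`s), NOT attempted.
This is not "finishing BSD". Theorems only; NO definition, NO named fact; class X10b keeps its label
CONSTRUCTION-SHAPED (NEEDS X_A3, referee R82.3 / RESIDUAL-MAP §I N2); nothing is booked by this file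
(the lane books, the referee rules); everything is PER PAIR; no census number moves.

## What (x10 GEN 26, X10-AUDIT §32)

GEN 24's `X10/UnitRoadPartnerRecordsD.lean` (X_A3 at the pair) and GEN 25's
`X10/UnitRoadPartnerBSDRecordsD.lean` (`BSDp W 3`) recorded these cells by the TRIVIAL-PARTNER road:
the partner `A` (`338d1`, `6845b1`, `13225a1` or `256d1`) has TRIVIAL `3`-primary arithmetic, so Mazur's
main conjecture holds for `A` trivially, and Greenberg–Vatsal 2000 Thm. (1.4) (`hGV`) transports it along
the kernel Hesse certificate C1 (`torsionIso_p<A>_u<E>` / `torsionIso_cm256d1_t<E>`). There the road for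
`A` carried `hkato` (Kato 2004 Thm. 17.4 (1)), `hGr` (Greenberg 1999 Thm. 4.1), `h5`, `h3`. THIS GEN
(`X10/UnitRoadProp38`): `X(A/ℚ_∞) = 0` by Greenberg's Prop. 3.8 PROVED in the tree (team n1011), so the
road for `A` needs the period unit `h3` ONLY. Records re-issued over `X10/UnitRoadProp38IntModel` §2–§3
with the SAME kernel numerals / Hesse certificates BY NAME and the partner's Tamagawa binder discharged by
GEN 25's `not_three_dvd_tamagawaProduct_p<A>`:
* `mazurMainConjecture_partner_u<E>_p38` — X_A3 at the pair; displayed binders PUBLISHED `h3`, `hGV`;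
  census `hLA`, `hSelA` (the PARTNER's Cremona row: conductor `≤ 13225`, rank `0`, `#Ш_an = 1`);
* `bsdp_partner_u<E>_p38` — `BSD(E,3)`; analytic rank `0`: PUBLISHED `h3`, `hGV` + the MC ⇒ BSD bridge
  `hGr` (Greenberg 4.1 via CGLS Thm. 5.1.4's deduction), `hmod`, `hGZK`; `hr0`; analytic rank `1`:
  PUBLISHED `h3`, `hGV`, `hS`, `hPR`, `hMT`, `hmod`, `hGZK`; `hr1`; the per-curve CERTIFICATE `hSch`
  (canonical `3`-adic height non-degenerate; values on file `UP-R1-SCHNEIDER-CERTS-x10g25.tsv`, two engines,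
  displayed not discharged) — NO Kato, NO Greenberg 4.1 in rank one, NO `h5`.
Per pair; class statement untouched; nothing booked. Script `HOME/b2b-bsdres-x10/g26/gen/mkp38.py`.

References: R. Greenberg, V. Vatsal, Invent. Math. 142 (2000) Thm. (1.4), §3 [GreenbergVatsal2000]; R.
Greenberg, LNM 1716 (1999) Prop. 3.8, Thm. 4.1 [GreenbergLNM1716]; F. Castella, G. Grossi, J. Lee, C.
Skinner, Invent. Math. 227 (2022) Thm. 5.1.4 [CastellaEtAl2021]; B. Perrin-Riou, Invent. Math. 89 (1987)
§1.4 [PerrinRiou1987]; J. Balakrishnan, J. S. Müller, W. Stein, Math. Comp. 85 (2016) Thm. 1.7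
[BalakrishnanMullerStein2015]; B. Mazur, J. Tate, Duke Math. J. 62 (1991) [MazurTate1991]; T. Fisher, Proc.
LMS 104 (2012) Thm. 13.2 [Fisher2012Hessian]; R. L. Miller, LMS J. Comput. Math. 14 (2011) Def. 1.1
[Miller2011LMS]; J. E. Cremona, tables [Cremona2006].
-/

set_option autoImplicit false

noncomputable section

open scoped Classical MatrixGroups ModularForm

open CongruenceSubgroup WeierstrassCurve Literature.NumberTheory.EllipticCurves
  Literature.NumberTheory.EllipticCurves.ModularForms Literature.NumberTheory.EllipticCurves.Rank1Residual
  Literature.NumberTheory.EllipticCurves.Rank1Residual.X11RankOneCertificates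
  Summit.BirchSwinnertonDyer.BirchSwinnertonDyer.Rank1Residual.IntModel
  Summit.BirchSwinnertonDyer.BirchSwinnertonDyer.Rank1Residual.X11RankOne
  Summit.BirchSwinnertonDyer.BirchSwinnertonDyer.Theorems.Rank1ResidualX1Defs

namespace Summit.BirchSwinnertonDyer.Rank1Residual.X10.UnitRoad
/-! ### `316030dj1` (3Ns, N = 316030, r_an = 1, ∏ c_ℓ = 162) ← `338d1` -/

/-- **X_A3 AT THE PAIR `(316030dj1, 3)` by the TRIVIAL-PARTNER road, Kato-FREE: `MazurMainConjecture W 3` with named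
facts `h3`, `hGV` ONLY.** Target `316030dj1 = [1, 1, 1, -62475, -6211015]` (`N = 316030 = 2 · 5 · 11 · 13^2 · 17`, census image `3Ns`; analytic rank `1`,
`∏ c_ℓ = 162`, `#Ш_an = 1` — NOT a unit cell; `#Ẽ(𝔽₃) = 2`, `a₃ = 2`; Frobenius witness `ℓ = 7`,
`#Ẽ(𝔽_{7}) = 5`); partner `A = 338d1 = [1, 1, 0, 504, -13112]` (`N_A = 338 = 2 · 13²`; Cremona: rank `0`, `#A(ℚ)_tors = 1`,
`#Ш_an = 1`, `L/Ω = 2`; `∏ c_ℓ(A) = 2` IN THE KERNEL, `not_three_dvd_tamagawaProduct_p338d1`; `#Ã(𝔽₃) = 5`: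
good ordinary NON-anomalous, so `X(A/ℚ_∞) = 0` by Greenberg's Prop. 3.8 in the tree); C1 = `torsionIso_p338d1_u316030dj1` (kernel
Hesse certificate). GEN 24's `mazurMainConjecture_partner_u316030dj1` re-issued over
`mazurMainConjecture_three_of_ainvs_of_trivialPartner_prop38`. Displayed binders: PUBLISHED `h3`, `hGV`; census
`hLA`, `hSelA` (the PARTNER's row). Per pair; class statement untouched; nothing booked.
[cite: GreenbergVatsal2000, Thm. (1.4) (arXiv p. 5)] [cite: GreenbergLNM1716, §3 Prop. 3.8 and Remark (pp. 95–96)]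
[cite: Fisher2012Hessian, Thm. 13.2 and §13] [cite: Cremona2006, Table 1 (Cremona labels 316030dj1, 338d1)] -/
theorem mazurMainConjecture_partner_u316030dj1_p38
    (h3 : realPeriodRat_eq_unit_mul_plusPeriod_three)
    (hGV : GreenbergVatsal2000.thm14_mainConjecture_transfer_of_torsionIso)
    (W A : WeierstrassCurve ℚ) [W.IsElliptic] [W.IsGloballyMinimal] [A.IsElliptic] [A.IsGloballyMinimal]
    [Fact (Nat.Prime 3)]
    (hW : W = ⟨1, 1, 1, (-62475), (-6211015)⟩) (hA : A = ⟨1, 1, 0, 504, (-13112)⟩)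
    (hLA : ∃ q : ℚ, q ≠ 0 ∧ A.entireLFunction 1 / (A.realPeriodRat : ℂ) = (q : ℂ) ∧ padicValRat 3 q = 0)
    (hSelA : Nat.card (A.selmerGroupPInfty 3) = 1) :
    MazurMainConjecture W 3 := by
  have hIW : integralModelInt W = ⟨1, 1, 1, (-62475), (-6211015)⟩ :=
    integralModelInt_eq_of_map_eq _ (by rw [hW]; ext <;> simp [WeierstrassCurve.map])
  have hIA : integralModelInt A = ⟨1, 1, 0, 504, (-13112)⟩ :=
    integralModelInt_eq_of_map_eq _ (by rw [hA]; ext <;> simp [WeierstrassCurve.map])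
  haveI : Fact (Nat.Prime 7) := ⟨by norm_num⟩
  exact mazurMainConjecture_three_of_ainvs_of_trivialPartner_prop38 h3 hGV
    1 1 1 (-62475) (-6211015) hIW 1 1 0 504 (-13112) hIA 7 5 2 5
    (by decide +kernel) card_u316030dj1_3 (by decide) (by decide) (by decide +kernel) card_u316030dj1_7
    (by decide +kernel) (by decide +kernel) card_p338d1_3 (by decide) (by decide)
    (not_three_dvd_tamagawaProduct_p338d1 hIA) hLA hSelA (torsionIso_p338d1_u316030dj1 W A hW hA)

/-- **`BSD(E,3)` AT THE PAIR `(316030dj1, 3)` — an N2 cell of ANALYTIC RANK ONE — by the TRIVIAL-PARTNER road,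
Kato- and Greenberg-4.1-FREE, MODULO the Schneider certificate: `BSDp W 3`.** Target `316030dj1` (`N = 316030`; Cremona
`allbsd`: analytic rank `1` (`hr1`), `#E(ℚ)_tors = 1`, `∏ c_ℓ = 162` (`ord₃ = 4`), `#Ш_an = 1` — the recorded
`BSD(E,3)` reads `ord₃ (L'(E,1)/(Ω_E·Reg_E)) = ord₃ (#Ш(E)·∏ c_ℓ / #E(ℚ)²_tors)`, `= 4` on Cremona's data);
partner `A = 338d1` as above. GEN 25's `bsdp_partner_u316030dj1` re-issued over
`bsdp_three_of_ainvs_of_trivialPartner_rankOne_of_schneider_prop38`. Displayed binders: PUBLISHED `h3`, `hGV`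
(the road), `hS`, `hPR`, `hMT`, `hmod`, `hGZK` (the MC ⇒ BSD bridge at rank `1`); census `hLA`, `hSelA` (the
PARTNER's row); `hr1`; the CERTIFICATE `hSch` (non-degeneracy of the canonical cyclotomic `3`-adic height of
`E`: YES on two engines, `UP-R1-SCHNEIDER-CERTS-x10g25.tsv`, kit j193417 — displayed, not discharged). NO
Kato, NO Greenberg 4.1, NO `h5`. Per pair; nothing booked. [cite: GreenbergVatsal2000, Thm. (1.4) (arXiv p. 5)]
[cite: GreenbergLNM1716, §3 Prop. 3.8 (p. 95)] [cite: PerrinRiou1987, §1.4 Cor. 1.8]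
[cite: BalakrishnanMullerStein2015, Thm. 1.7] [cite: MazurTate1991, Thm. 3.1] [cite: Miller2011LMS, Def. 1.1]
[cite: Cremona2006, Table 1 (Cremona labels 316030dj1, 338d1)] -/
theorem bsdp_partner_u316030dj1_p38
    (h3 : realPeriodRat_eq_unit_mul_plusPeriod_three)
    (hGV : GreenbergVatsal2000.thm14_mainConjecture_transfer_of_torsionIso)
    (hS : Schneider1985_order_charGenerator_odd) (hPR : perrinRiou_rankOne_leadingTerms_odd)
    (hMT : mazur_tate_sigma_exists_odd) (hmod : nonempty_modularParametrizationData)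
    (hGZK : rank_eq_analyticRank_of_analyticRank_le_one)
    (W A : WeierstrassCurve ℚ) [W.IsElliptic] [W.IsGloballyMinimal] [A.IsElliptic] [A.IsGloballyMinimal]
    [Fact (Nat.Prime 3)]
    (hW : W = ⟨1, 1, 1, (-62475), (-6211015)⟩) (hA : A = ⟨1, 1, 0, 504, (-13112)⟩)
    (hLA : ∃ q : ℚ, q ≠ 0 ∧ A.entireLFunction 1 / (A.realPeriodRat : ℂ) = (q : ℂ) ∧ padicValRat 3 q = 0)
    (hSelA : Nat.card (A.selmerGroupPInfty 3) = 1)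
    (hr1 : W.analyticRank = 1)
    (hSch : ∀ Dh : PAdicHeightData W 3, Dh.IsCanonical → SchneiderConjecture Dh) :
    BSDp W 3 := by
  have hIW : integralModelInt W = ⟨1, 1, 1, (-62475), (-6211015)⟩ :=
    integralModelInt_eq_of_map_eq _ (by rw [hW]; ext <;> simp [WeierstrassCurve.map])
  have hIA : integralModelInt A = ⟨1, 1, 0, 504, (-13112)⟩ :=
    integralModelInt_eq_of_map_eq _ (by rw [hA]; ext <;> simp [WeierstrassCurve.map])
  haveI : Fact (Nat.Prime 7) := ⟨by norm_num⟩
  exact bsdp_three_of_ainvs_of_trivialPartner_rankOne_of_schneider_prop38 h3 hGV hS hPR hMT hmod hGZK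
    1 1 1 (-62475) (-6211015) hIW 1 1 0 504 (-13112) hIA 7 5 2 5
    (by decide +kernel) card_u316030dj1_3 (by decide) (by decide) (by decide +kernel) card_u316030dj1_7
    (by decide +kernel) (by decide +kernel) card_p338d1_3 (by decide) (by decide)
    (not_three_dvd_tamagawaProduct_p338d1 hIA) hLA hSelA (torsionIso_p338d1_u316030dj1 W A hW hA) hr1 hSch

/-! ### `334282o1` (3Ns, N = 334282, r_an = 0, ∏ c_ℓ = 18) ← `338d1` -/

/-- **X_A3 AT THE PAIR `(334282o1, 3)` by the TRIVIAL-PARTNER road, Kato-FREE: `MazurMainConjecture W 3` with named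
facts `h3`, `hGV` ONLY.** Target `334282o1 = [1, 1, 1, -1349, 198739]` (`N = 334282 = 2 · 13^2 · 23 · 43`, census image `3Ns`; analytic rank `0`,
`∏ c_ℓ = 18`, `#Ш_an = 1` — NOT a unit cell; `#Ẽ(𝔽₃) = 2`, `a₃ = 2`; Frobenius witness `ℓ = 7`,
`#Ẽ(𝔽_{7}) = 8`); partner `A = 338d1 = [1, 1, 0, 504, -13112]` (`N_A = 338 = 2 · 13²`; Cremona: rank `0`, `#A(ℚ)_tors = 1`,
`#Ш_an = 1`, `L/Ω = 2`; `∏ c_ℓ(A) = 2` IN THE KERNEL, `not_three_dvd_tamagawaProduct_p338d1`; `#Ã(𝔽₃) = 5`: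
good ordinary NON-anomalous, so `X(A/ℚ_∞) = 0` by Greenberg's Prop. 3.8 in the tree); C1 = `torsionIso_p338d1_u334282o1` (kernel
Hesse certificate). GEN 24's `mazurMainConjecture_partner_u334282o1` re-issued over
`mazurMainConjecture_three_of_ainvs_of_trivialPartner_prop38`. Displayed binders: PUBLISHED `h3`, `hGV`; census
`hLA`, `hSelA` (the PARTNER's row). Per pair; class statement untouched; nothing booked.
[cite: GreenbergVatsal2000, Thm. (1.4) (arXiv p. 5)] [cite: GreenbergLNM1716, §3 Prop. 3.8 and Remark (pp. 95–96)]
[cite: Fisher2012Hessian, Thm. 13.2 and §13] [cite: Cremona2006, Table 1 (Cremona labels 334282o1, 338d1)] -/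
theorem mazurMainConjecture_partner_u334282o1_p38
    (h3 : realPeriodRat_eq_unit_mul_plusPeriod_three)
    (hGV : GreenbergVatsal2000.thm14_mainConjecture_transfer_of_torsionIso)
    (W A : WeierstrassCurve ℚ) [W.IsElliptic] [W.IsGloballyMinimal] [A.IsElliptic] [A.IsGloballyMinimal]
    [Fact (Nat.Prime 3)]
    (hW : W = ⟨1, 1, 1, (-1349), 198739⟩) (hA : A = ⟨1, 1, 0, 504, (-13112)⟩)
    (hLA : ∃ q : ℚ, q ≠ 0 ∧ A.entireLFunction 1 / (A.realPeriodRat : ℂ) = (q : ℂ) ∧ padicValRat 3 q = 0)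
    (hSelA : Nat.card (A.selmerGroupPInfty 3) = 1) :
    MazurMainConjecture W 3 := by
  have hIW : integralModelInt W = ⟨1, 1, 1, (-1349), 198739⟩ :=
    integralModelInt_eq_of_map_eq _ (by rw [hW]; ext <;> simp [WeierstrassCurve.map])
  have hIA : integralModelInt A = ⟨1, 1, 0, 504, (-13112)⟩ :=
    integralModelInt_eq_of_map_eq _ (by rw [hA]; ext <;> simp [WeierstrassCurve.map])
  haveI : Fact (Nat.Prime 7) := ⟨by norm_num⟩
  exact mazurMainConjecture_three_of_ainvs_of_trivialPartner_prop38 h3 hGV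
    1 1 1 (-1349) 198739 hIW 1 1 0 504 (-13112) hIA 7 8 2 5
    (by decide +kernel) card_u334282o1_3 (by decide) (by decide) (by decide +kernel) card_u334282o1_7
    (by decide +kernel) (by decide +kernel) card_p338d1_3 (by decide) (by decide)
    (not_three_dvd_tamagawaProduct_p338d1 hIA) hLA hSelA (torsionIso_p338d1_u334282o1 W A hW hA)

/-- **`BSD(E,3)` AT THE PAIR `(334282o1, 3)` by the TRIVIAL-PARTNER road, Kato-FREE: `BSDp W 3`** — analytic rank `0`,
NO descent / `L`-value / Tamagawa datum of the target used. Target `334282o1` (`N = 334282`; Cremona `allbsd`: analytic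
rank `0` (`hr0`), `#E(ℚ)_tors = 1`, `∏ c_ℓ = 18` (`ord₃ = 2`), `#Ш_an = 1` — the recorded `BSD(E,3)` reads
`ord₃ (L(E,1)/Ω_E) = ord₃ (#Ш(E)·∏ c_ℓ / #E(ℚ)²_tors)`, `= 2` on Cremona's data); partner `A = 338d1` as above.
GEN 25's `bsdp_partner_u334282o1` re-issued over `bsdp_three_of_ainvs_of_trivialPartner_rankZero_prop38`.
Displayed binders: PUBLISHED `h3`, `hGV` (the road) and `hGr`, `hmod`, `hGZK` (the MC ⇒ BSD bridge at rank
`0`); census `hLA`, `hSelA` (the PARTNER's row); `hr0`. NO Kato, NO `h5`. Per pair; nothing booked.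
[cite: GreenbergVatsal2000, Thm. (1.4) (arXiv p. 5)] [cite: GreenbergLNM1716, Thm. 4.1 (p. 102) and §3 Prop. 3.8 (p. 95)]
[cite: CastellaEtAl2021, Thm. 5.1.4 (proof, §5.1.3)] [cite: Miller2011LMS, Def. 1.1]
[cite: Cremona2006, Table 1 (Cremona labels 334282o1, 338d1)] -/
theorem bsdp_partner_u334282o1_p38
    (hGr : greenberg_charValue_rankZero) (h3 : realPeriodRat_eq_unit_mul_plusPeriod_three)
    (hGV : GreenbergVatsal2000.thm14_mainConjecture_transfer_of_torsionIso)
    (hmod : nonempty_modularParametrizationData)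
    (hGZK : rank_eq_analyticRank_of_analyticRank_le_one)
    (W A : WeierstrassCurve ℚ) [W.IsElliptic] [W.IsGloballyMinimal] [A.IsElliptic] [A.IsGloballyMinimal]
    [Fact (Nat.Prime 3)]
    (hW : W = ⟨1, 1, 1, (-1349), 198739⟩) (hA : A = ⟨1, 1, 0, 504, (-13112)⟩)
    (hLA : ∃ q : ℚ, q ≠ 0 ∧ A.entireLFunction 1 / (A.realPeriodRat : ℂ) = (q : ℂ) ∧ padicValRat 3 q = 0)
    (hSelA : Nat.card (A.selmerGroupPInfty 3) = 1)
    (hr0 : W.analyticRank = 0) :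
    BSDp W 3 := by
  have hIW : integralModelInt W = ⟨1, 1, 1, (-1349), 198739⟩ :=
    integralModelInt_eq_of_map_eq _ (by rw [hW]; ext <;> simp [WeierstrassCurve.map])
  have hIA : integralModelInt A = ⟨1, 1, 0, 504, (-13112)⟩ :=
    integralModelInt_eq_of_map_eq _ (by rw [hA]; ext <;> simp [WeierstrassCurve.map])
  haveI : Fact (Nat.Prime 7) := ⟨by norm_num⟩
  exact bsdp_three_of_ainvs_of_trivialPartner_rankZero_prop38 hGr h3 hGV hmod hGZK
    1 1 1 (-1349) 198739 hIW 1 1 0 504 (-13112) hIA 7 8 2 5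
    (by decide +kernel) card_u334282o1_3 (by decide) (by decide) (by decide +kernel) card_u334282o1_7
    (by decide +kernel) (by decide +kernel) card_p338d1_3 (by decide) (by decide)
    (not_three_dvd_tamagawaProduct_p338d1 hIA) hLA hSelA (torsionIso_p338d1_u334282o1 W A hW hA) hr0

/-! ### `375518bo1` (3Ns, N = 375518, r_an = 1, ∏ c_ℓ = 108) ← `338d1` -/

/-- **X_A3 AT THE PAIR `(375518bo1, 3)` by the TRIVIAL-PARTNER road, Kato-FREE: `MazurMainConjecture W 3` with named
facts `h3`, `hGV` ONLY.** Target `375518bo1 = [1, 1, 1, 3213616, 18803556793]` (`N = 375518 = 2 · 11 · 13^2 · 101`, census image `3Ns`; analytic rank `1`,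
`∏ c_ℓ = 108`, `#Ш_an = 1` — NOT a unit cell; `#Ẽ(𝔽₃) = 2`, `a₃ = 2`; Frobenius witness `ℓ = 7`,
`#Ẽ(𝔽_{7}) = 8`); partner `A = 338d1 = [1, 1, 0, 504, -13112]` (`N_A = 338 = 2 · 13²`; Cremona: rank `0`, `#A(ℚ)_tors = 1`,
`#Ш_an = 1`, `L/Ω = 2`; `∏ c_ℓ(A) = 2` IN THE KERNEL, `not_three_dvd_tamagawaProduct_p338d1`; `#Ã(𝔽₃) = 5`:
good ordinary NON-anomalous, so `X(A/ℚ_∞) = 0` by Greenberg's Prop. 3.8 in the tree); C1 = `torsionIso_p338d1_u375518bo1` (kernel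
Hesse certificate). GEN 24's `mazurMainConjecture_partner_u375518bo1` re-issued over
`mazurMainConjecture_three_of_ainvs_of_trivialPartner_prop38`. Displayed binders: PUBLISHED `h3`, `hGV`; census
`hLA`, `hSelA` (the PARTNER's row). Per pair; class statement untouched; nothing booked.
[cite: GreenbergVatsal2000, Thm. (1.4) (arXiv p. 5)] [cite: GreenbergLNM1716, §3 Prop. 3.8 and Remark (pp. 95–96)]
[cite: Fisher2012Hessian, Thm. 13.2 and §13] [cite: Cremona2006, Table 1 (Cremona labels 375518bo1, 338d1)] -/
theorem mazurMainConjecture_partner_u375518bo1_p38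
    (h3 : realPeriodRat_eq_unit_mul_plusPeriod_three)
    (hGV : GreenbergVatsal2000.thm14_mainConjecture_transfer_of_torsionIso)
    (W A : WeierstrassCurve ℚ) [W.IsElliptic] [W.IsGloballyMinimal] [A.IsElliptic] [A.IsGloballyMinimal]
    [Fact (Nat.Prime 3)]
    (hW : W = ⟨1, 1, 1, 3213616, 18803556793⟩) (hA : A = ⟨1, 1, 0, 504, (-13112)⟩)
    (hLA : ∃ q : ℚ, q ≠ 0 ∧ A.entireLFunction 1 / (A.realPeriodRat : ℂ) = (q : ℂ) ∧ padicValRat 3 q = 0)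
    (hSelA : Nat.card (A.selmerGroupPInfty 3) = 1) :
    MazurMainConjecture W 3 := by
  have hIW : integralModelInt W = ⟨1, 1, 1, 3213616, 18803556793⟩ :=
    integralModelInt_eq_of_map_eq _ (by rw [hW]; ext <;> simp [WeierstrassCurve.map])
  have hIA : integralModelInt A = ⟨1, 1, 0, 504, (-13112)⟩ :=
    integralModelInt_eq_of_map_eq _ (by rw [hA]; ext <;> simp [WeierstrassCurve.map])
  haveI : Fact (Nat.Prime 7) := ⟨by norm_num⟩
  exact mazurMainConjecture_three_of_ainvs_of_trivialPartner_prop38 h3 hGV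
    1 1 1 3213616 18803556793 hIW 1 1 0 504 (-13112) hIA 7 8 2 5
    (by decide +kernel) card_u375518bo1_3 (by decide) (by decide) (by decide +kernel) card_u375518bo1_7
    (by decide +kernel) (by decide +kernel) card_p338d1_3 (by decide) (by decide)
    (not_three_dvd_tamagawaProduct_p338d1 hIA) hLA hSelA (torsionIso_p338d1_u375518bo1 W A hW hA)

/-- **`BSD(E,3)` AT THE PAIR `(375518bo1, 3)` — an N2 cell of ANALYTIC RANK ONE — by the TRIVIAL-PARTNER road,
Kato- and Greenberg-4.1-FREE, MODULO the Schneider certificate: `BSDp W 3`.** Target `375518bo1` (`N = 375518`; Cremona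
`allbsd`: analytic rank `1` (`hr1`), `#E(ℚ)_tors = 1`, `∏ c_ℓ = 108` (`ord₃ = 3`), `#Ш_an = 1` — the recorded
`BSD(E,3)` reads `ord₃ (L'(E,1)/(Ω_E·Reg_E)) = ord₃ (#Ш(E)·∏ c_ℓ / #E(ℚ)²_tors)`, `= 3` on Cremona's data);
partner `A = 338d1` as above. GEN 25's `bsdp_partner_u375518bo1` re-issued over
`bsdp_three_of_ainvs_of_trivialPartner_rankOne_of_schneider_prop38`. Displayed binders: PUBLISHED `h3`, `hGV`
(the road), `hS`, `hPR`, `hMT`, `hmod`, `hGZK` (the MC ⇒ BSD bridge at rank `1`); census `hLA`, `hSelA` (the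
PARTNER's row); `hr1`; the CERTIFICATE `hSch` (non-degeneracy of the canonical cyclotomic `3`-adic height of
`E`: YES on two engines, `UP-R1-SCHNEIDER-CERTS-x10g25.tsv`, kit j193417 — displayed, not discharged). NO
Kato, NO Greenberg 4.1, NO `h5`. Per pair; nothing booked. [cite: GreenbergVatsal2000, Thm. (1.4) (arXiv p. 5)]
[cite: GreenbergLNM1716, §3 Prop. 3.8 (p. 95)] [cite: PerrinRiou1987, §1.4 Cor. 1.8]
[cite: BalakrishnanMullerStein2015, Thm. 1.7] [cite: MazurTate1991, Thm. 3.1] [cite: Miller2011LMS, Def. 1.1]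
[cite: Cremona2006, Table 1 (Cremona labels 375518bo1, 338d1)] -/
theorem bsdp_partner_u375518bo1_p38
    (h3 : realPeriodRat_eq_unit_mul_plusPeriod_three)
    (hGV : GreenbergVatsal2000.thm14_mainConjecture_transfer_of_torsionIso)
    (hS : Schneider1985_order_charGenerator_odd) (hPR : perrinRiou_rankOne_leadingTerms_odd)
    (hMT : mazur_tate_sigma_exists_odd) (hmod : nonempty_modularParametrizationData)
    (hGZK : rank_eq_analyticRank_of_analyticRank_le_one)
    (W A : WeierstrassCurve ℚ) [W.IsElliptic] [W.IsGloballyMinimal] [A.IsElliptic] [A.IsGloballyMinimal]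
    [Fact (Nat.Prime 3)]
    (hW : W = ⟨1, 1, 1, 3213616, 18803556793⟩) (hA : A = ⟨1, 1, 0, 504, (-13112)⟩)
    (hLA : ∃ q : ℚ, q ≠ 0 ∧ A.entireLFunction 1 / (A.realPeriodRat : ℂ) = (q : ℂ) ∧ padicValRat 3 q = 0)
    (hSelA : Nat.card (A.selmerGroupPInfty 3) = 1)
    (hr1 : W.analyticRank = 1)
    (hSch : ∀ Dh : PAdicHeightData W 3, Dh.IsCanonical → SchneiderConjecture Dh) :
    BSDp W 3 := by
  have hIW : integralModelInt W = ⟨1, 1, 1, 3213616, 18803556793⟩ :=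
    integralModelInt_eq_of_map_eq _ (by rw [hW]; ext <;> simp [WeierstrassCurve.map])
  have hIA : integralModelInt A = ⟨1, 1, 0, 504, (-13112)⟩ :=
    integralModelInt_eq_of_map_eq _ (by rw [hA]; ext <;> simp [WeierstrassCurve.map])
  haveI : Fact (Nat.Prime 7) := ⟨by norm_num⟩
  exact bsdp_three_of_ainvs_of_trivialPartner_rankOne_of_schneider_prop38 h3 hGV hS hPR hMT hmod hGZK
    1 1 1 3213616 18803556793 hIW 1 1 0 504 (-13112) hIA 7 8 2 5
    (by decide +kernel) card_u375518bo1_3 (by decide) (by decide) (by decide +kernel) card_u375518bo1_7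
    (by decide +kernel) (by decide +kernel) card_p338d1_3 (by decide) (by decide)
    (not_three_dvd_tamagawaProduct_p338d1 hIA) hLA hSelA (torsionIso_p338d1_u375518bo1 W A hW hA) hr1 hSch

/-! ### `444470v1` (3Ns, N = 444470, r_an = 0, ∏ c_ℓ = 360) ← `338d1` -/

/-- **X_A3 AT THE PAIR `(444470v1, 3)` by the TRIVIAL-PARTNER road, Kato-FREE: `MazurMainConjecture W 3` with named
facts `h3`, `hGV` ONLY.** Target `444470v1 = [1, 1, 1, -116375035, -484025874935]` (`N = 444470 = 2 · 5 · 13^2 · 263`, census image `3Ns`; analytic rank `0`,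
`∏ c_ℓ = 360`, `#Ш_an = 1` — NOT a unit cell; `#Ẽ(𝔽₃) = 2`, `a₃ = 2`; Frobenius witness `ℓ = 7`,
`#Ẽ(𝔽_{7}) = 11`); partner `A = 338d1 = [1, 1, 0, 504, -13112]` (`N_A = 338 = 2 · 13²`; Cremona: rank `0`, `#A(ℚ)_tors = 1`,
`#Ш_an = 1`, `L/Ω = 2`; `∏ c_ℓ(A) = 2` IN THE KERNEL, `not_three_dvd_tamagawaProduct_p338d1`; `#Ã(𝔽₃) = 5`:
good ordinary NON-anomalous, so `X(A/ℚ_∞) = 0` by Greenberg's Prop. 3.8 in the tree); C1 = `torsionIso_p338d1_u444470v1` (kernel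
Hesse certificate). GEN 24's `mazurMainConjecture_partner_u444470v1` re-issued over
`mazurMainConjecture_three_of_ainvs_of_trivialPartner_prop38`. Displayed binders: PUBLISHED `h3`, `hGV`; census
`hLA`, `hSelA` (the PARTNER's row). Per pair; class statement untouched; nothing booked.
[cite: GreenbergVatsal2000, Thm. (1.4) (arXiv p. 5)] [cite: GreenbergLNM1716, §3 Prop. 3.8 and Remark (pp. 95–96)]
[cite: Fisher2012Hessian, Thm. 13.2 and §13] [cite: Cremona2006, Table 1 (Cremona labels 444470v1, 338d1)] -/
theorem mazurMainConjecture_partner_u444470v1_p38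
    (h3 : realPeriodRat_eq_unit_mul_plusPeriod_three)
    (hGV : GreenbergVatsal2000.thm14_mainConjecture_transfer_of_torsionIso)
    (W A : WeierstrassCurve ℚ) [W.IsElliptic] [W.IsGloballyMinimal] [A.IsElliptic] [A.IsGloballyMinimal]
    [Fact (Nat.Prime 3)]
    (hW : W = ⟨1, 1, 1, (-116375035), (-484025874935)⟩) (hA : A = ⟨1, 1, 0, 504, (-13112)⟩)
    (hLA : ∃ q : ℚ, q ≠ 0 ∧ A.entireLFunction 1 / (A.realPeriodRat : ℂ) = (q : ℂ) ∧ padicValRat 3 q = 0)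
    (hSelA : Nat.card (A.selmerGroupPInfty 3) = 1) :
    MazurMainConjecture W 3 := by
  have hIW : integralModelInt W = ⟨1, 1, 1, (-116375035), (-484025874935)⟩ :=
    integralModelInt_eq_of_map_eq _ (by rw [hW]; ext <;> simp [WeierstrassCurve.map])
  have hIA : integralModelInt A = ⟨1, 1, 0, 504, (-13112)⟩ :=
    integralModelInt_eq_of_map_eq _ (by rw [hA]; ext <;> simp [WeierstrassCurve.map])
  haveI : Fact (Nat.Prime 7) := ⟨by norm_num⟩
  exact mazurMainConjecture_three_of_ainvs_of_trivialPartner_prop38 h3 hGV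
    1 1 1 (-116375035) (-484025874935) hIW 1 1 0 504 (-13112) hIA 7 11 2 5
    (by decide +kernel) card_u444470v1_3 (by decide) (by decide) (by decide +kernel) card_u444470v1_7
    (by decide +kernel) (by decide +kernel) card_p338d1_3 (by decide) (by decide)
    (not_three_dvd_tamagawaProduct_p338d1 hIA) hLA hSelA (torsionIso_p338d1_u444470v1 W A hW hA)

/-- **`BSD(E,3)` AT THE PAIR `(444470v1, 3)` by the TRIVIAL-PARTNER road, Kato-FREE: `BSDp W 3`** — analytic rank `0`,
NO descent / `L`-value / Tamagawa datum of the target used. Target `444470v1` (`N = 444470`; Cremona `allbsd`: analytic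
rank `0` (`hr0`), `#E(ℚ)_tors = 1`, `∏ c_ℓ = 360` (`ord₃ = 2`), `#Ш_an = 1` — the recorded `BSD(E,3)` reads
`ord₃ (L(E,1)/Ω_E) = ord₃ (#Ш(E)·∏ c_ℓ / #E(ℚ)²_tors)`, `= 2` on Cremona's data); partner `A = 338d1` as above.
GEN 25's `bsdp_partner_u444470v1` re-issued over `bsdp_three_of_ainvs_of_trivialPartner_rankZero_prop38`.
Displayed binders: PUBLISHED `h3`, `hGV` (the road) and `hGr`, `hmod`, `hGZK` (the MC ⇒ BSD bridge at rank
`0`); census `hLA`, `hSelA` (the PARTNER's row); `hr0`. NO Kato, NO `h5`. Per pair; nothing booked.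
[cite: GreenbergVatsal2000, Thm. (1.4) (arXiv p. 5)] [cite: GreenbergLNM1716, Thm. 4.1 (p. 102) and §3 Prop. 3.8 (p. 95)]
[cite: CastellaEtAl2021, Thm. 5.1.4 (proof, §5.1.3)] [cite: Miller2011LMS, Def. 1.1]
[cite: Cremona2006, Table 1 (Cremona labels 444470v1, 338d1)] -/
theorem bsdp_partner_u444470v1_p38
    (hGr : greenberg_charValue_rankZero) (h3 : realPeriodRat_eq_unit_mul_plusPeriod_three)
    (hGV : GreenbergVatsal2000.thm14_mainConjecture_transfer_of_torsionIso)
    (hmod : nonempty_modularParametrizationData)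
    (hGZK : rank_eq_analyticRank_of_analyticRank_le_one)
    (W A : WeierstrassCurve ℚ) [W.IsElliptic] [W.IsGloballyMinimal] [A.IsElliptic] [A.IsGloballyMinimal]
    [Fact (Nat.Prime 3)]
    (hW : W = ⟨1, 1, 1, (-116375035), (-484025874935)⟩) (hA : A = ⟨1, 1, 0, 504, (-13112)⟩)
    (hLA : ∃ q : ℚ, q ≠ 0 ∧ A.entireLFunction 1 / (A.realPeriodRat : ℂ) = (q : ℂ) ∧ padicValRat 3 q = 0)
    (hSelA : Nat.card (A.selmerGroupPInfty 3) = 1)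
    (hr0 : W.analyticRank = 0) :
    BSDp W 3 := by
  have hIW : integralModelInt W = ⟨1, 1, 1, (-116375035), (-484025874935)⟩ :=
    integralModelInt_eq_of_map_eq _ (by rw [hW]; ext <;> simp [WeierstrassCurve.map])
  have hIA : integralModelInt A = ⟨1, 1, 0, 504, (-13112)⟩ :=
    integralModelInt_eq_of_map_eq _ (by rw [hA]; ext <;> simp [WeierstrassCurve.map])
  haveI : Fact (Nat.Prime 7) := ⟨by norm_num⟩
  exact bsdp_three_of_ainvs_of_trivialPartner_rankZero_prop38 hGr h3 hGV hmod hGZK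
    1 1 1 (-116375035) (-484025874935) hIW 1 1 0 504 (-13112) hIA 7 11 2 5
    (by decide +kernel) card_u444470v1_3 (by decide) (by decide) (by decide +kernel) card_u444470v1_7
    (by decide +kernel) (by decide +kernel) card_p338d1_3 (by decide) (by decide)
    (not_three_dvd_tamagawaProduct_p338d1 hIA) hLA hSelA (torsionIso_p338d1_u444470v1 W A hW hA) hr0

end Summit.BirchSwinnertonDyer.Rank1Residual.X10.UnitRoad

end
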